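import Mathlib
import Summits.Ventures.PercRepro2.Defs
import Summits.Ventures.PercRepro2.Independence
import Summits.Ventures.PercRepro2.Harris

/-!
# The three-event covariance lemma when `B = {some edge of Z is closed}` (blind cell PercRepro2,
p4 g32; proofs/P4-G32-STRUCTURE.md §3, Theorem B; S3 (G4-u) item (ap))

For increasing `G, H` and the decreasing event `B_Z = (allOpen Z)ᶜ = ⋃_{e ∈ Z} {ω e = false}`
(the complement of the principal increasing event `{ω ≥ 1_Z}`), every increasing `M` with
`↑(G ∩ B_Z) ⊆ M ⊆ G` satisfies `Cov(M, B_Z ∩ H) ≤ Cov(G, H)` — the cell's three-event lemma on this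
class (`M = ↑(G ∩ B_Z)` is the smallest admissible `M`, hence the strongest case).

**`cov_inter_closedUnion_le_cov`**: induction on `Z`, pinning one edge `e ∈ Z` (`prob_eq_pin`):
under `p[e↦0]` the whole space lies in `B_Z`, so `M = G` and `B_Z ∩ H = H` almost surely and the two
covariances agree; under `p[e↦1]` the event `B_Z` agrees with `B_{Z ∖ e}` and the induction
hypothesis applies with the same `M`; the cross term obeys `ΔM · Δ(B_Z ∩ H) ≤ ΔG · ΔH` because
`0 ≤ ΔM ≤ ΔG` and `Δ(B_Z ∩ H) ≤ ΔH` (both differences are taken against the closed fibre where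
`M = G`, `B_Z ∩ H = H`). The two pinning facts `cov_eq_pin_cu` / `prob_update_zero_le_prob_update_one_cu`
restate `ThreeEventPinning.lean`'s `cov_eq_pin'` / `prob_update_zero_le_prob_update_one'` (the file was
checked before that module's olean was served). No definition, no instance, no notation.
-/

namespace Summit.Ventures.PercRepro2

namespace ThreeEvent

section ClosedUnion

variable {E : Type*} [Fintype E] [DecidableEq E] {R : Type*} [CommRing R]

omit [Fintype E] [DecidableEq E] in
/-- `(allOpen ∅)ᶜ = ∅`. -/
lemma compl_allOpen_empty : ((allOpen (∅ : Finset E))ᶜ : Set (Config E)) = ∅ := by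
  ext ω
  simp [allOpen]

omit [Fintype E] [DecidableEq E] in
/-- `closedEdge e ⊆ (allOpen Z)ᶜ` for `e ∈ Z`. -/
lemma closedEdge_subset_compl_allOpen {Z : Finset E} {e : E} (he : e ∈ Z) :
    closedEdge e ⊆ (allOpen Z)ᶜ := by
  intro ω hω hall
  have := (mem_allOpen.1 hall) e he
  simp [closedEdge] at hω
  rw [this] at hω
  exact Bool.noConfusion hω

omit [Fintype E] in
/-- On `{ω e = true}`, `(allOpen (insert e Z))ᶜ` agrees with `(allOpen Z)ᶜ`. -/
lemma compl_allOpen_insert_inter_openEdge (Z : Finset E) (e : E) :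
    (allOpen (insert e Z))ᶜ ∩ openEdge e = (allOpen Z)ᶜ ∩ openEdge e := by
  ext ω
  simp only [Set.mem_inter_iff, Set.mem_compl_iff, mem_allOpen, openEdge, Set.mem_setOf_eq,
    Finset.mem_insert, forall_eq_or_imp]
  constructor
  · rintro ⟨h, he⟩
    exact ⟨fun hZ => h ⟨he, hZ⟩, he⟩
  · rintro ⟨h, he⟩
    exact ⟨fun hall => h hall.2, he⟩

/-- Under `p[e↦0]` an event agrees with its intersection with `closedEdge e`; so two events that
agree on `closedEdge e` have the same probability. -/
lemma prob_update_zero_congr (p : E → R) {A A' : Set (Config E)} {e : E}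
    (h : A ∩ closedEdge e = A' ∩ closedEdge e) :
    prob (Function.update p e 0) A = prob (Function.update p e 0) A' := by
  rw [← prob_update_zero_inter_closedEdge p A e, ← prob_update_zero_inter_closedEdge p A' e, h]

/-- Under `p[e↦1]`, two events that agree on `openEdge e` have the same probability. -/
lemma prob_update_one_congr (p : E → R) {A A' : Set (Config E)} {e : E}
    (h : A ∩ openEdge e = A' ∩ openEdge e) :
    prob (Function.update p e 1) A = prob (Function.update p e 1) A' := by
  rw [← prob_update_one_inter_openEdge p A e, ← prob_update_one_inter_openEdge p A' e, h]

/-- The covariance `P(X ∩ Y) − P(X) P(Y)`, pinned at an edge (as `ThreeEventPinning.cov_eq_pin'`). -/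
lemma cov_eq_pin_cu (p : E → R) (X Y : Set (Config E)) (e : E) :
    prob p (X ∩ Y) - prob p X * prob p Y =
      p e * (prob (Function.update p e 1) (X ∩ Y)
          - prob (Function.update p e 1) X * prob (Function.update p e 1) Y)
      + (1 - p e) * (prob (Function.update p e 0) (X ∩ Y)
          - prob (Function.update p e 0) X * prob (Function.update p e 0) Y)
      + p e * (1 - p e) * ((prob (Function.update p e 1) X - prob (Function.update p e 0) X)
          * (prob (Function.update p e 1) Y - prob (Function.update p e 0) Y)) := by
  rw [prob_eq_pin p (X ∩ Y) e, prob_eq_pin p X e, prob_eq_pin p Y e]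
  ring

end ClosedUnion

section Main

variable {E : Type*} [Fintype E] [DecidableEq E] {R : Type*} [CommRing R] [LinearOrder R]
  [IsStrictOrderedRing R]

/-- For an increasing event, pinning an edge open dominates pinning it closed (as
`ThreeEventPinning.prob_update_zero_le_prob_update_one'`). -/
lemma prob_update_zero_le_prob_update_one_cu {p : E → R} (hp : IsProbVec p) {A : Set (Config E)}
    (hA : IsUpperSet A) (e : E) :
    prob (Function.update p e 0) A ≤ prob (Function.update p e 1) A := by
  rw [prob_eq_expect_indicator, prob_eq_expect_indicator]
  exact expect_update_zero_le_expect_update_one hp (monotone_indicator_of_isUpperSet hA) e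

/-- **Theorem B (three-event lemma for `B = {some edge of Z is closed}`)**: for increasing `G, H` and
an increasing `M` with `↑(G ∩ (allOpen Z)ᶜ) ⊆ M ⊆ G`,
`Cov(M, (allOpen Z)ᶜ ∩ H) ≤ Cov(G, H)`. -/
theorem cov_inter_closedUnion_le_cov (Z : Finset E) :
    ∀ {G H M : Set (Config E)}, IsUpperSet G → IsUpperSet H → IsUpperSet M → M ⊆ G →
      (∀ ω, ω ∈ G → ω ∈ (allOpen Z)ᶜ → ω ∈ M) →
      ∀ {p : E → R}, IsProbVec p →
        prob p (M ∩ ((allOpen Z)ᶜ ∩ H)) - prob p M * prob p ((allOpen Z)ᶜ ∩ H)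
          ≤ prob p (G ∩ H) - prob p G * prob p H := by
  classical
  induction Z using Finset.induction_on with
  | empty =>
    intro G H M hG hH _ _ _ p hp
    rw [compl_allOpen_empty, Set.empty_inter, Set.inter_empty]
    have := prob_mul_prob_le_prob_inter hp hG hH
    have h0 : prob p (∅ : Set (Config E)) = 0 := by unfold prob; simp
    rw [h0]
    linarith
  | insert e Z' heZ' ih =>
    intro G H M hG hH hM hMG hGBM p hp
    set B := ((allOpen (insert e Z'))ᶜ : Set (Config E)) with hBdef
    set B' := ((allOpen Z')ᶜ : Set (Config E)) with hB'def
    set p₀ := Function.update p e 0 with hp₀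
    set p₁ := Function.update p e 1 with hp₁
    have hp0' : IsProbVec p₀ := hp.update e le_rfl zero_le_one
    have hp1' : IsProbVec p₁ := hp.update e zero_le_one le_rfl
    have ha0 : 0 ≤ p e := hp.nonneg e
    have ha1 : 0 ≤ 1 - p e := sub_nonneg.2 (hp.le_one e)
    have heZ : e ∈ insert e Z' := Finset.mem_insert_self e Z'
    -- (i) under `p₁`: `B` agrees with `B'`, and the induction hypothesis applies with the same `M`
    have hB1 : B ∩ openEdge e = B' ∩ openEdge e := compl_allOpen_insert_inter_openEdge Z' e
    have hB1' : ∀ ω, ω ∈ openEdge e → (ω ∈ B ↔ ω ∈ B') := fun ω hωe => by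
      have := Set.ext_iff.1 hB1 ω
      simp only [Set.mem_inter_iff] at this
      exact ⟨fun hB => (this.1 ⟨hB, hωe⟩).1, fun hB' => (this.2 ⟨hB', hωe⟩).1⟩
    have hMBH1 : prob p₁ (M ∩ (B ∩ H)) = prob p₁ (M ∩ (B' ∩ H)) :=
      prob_update_one_congr p (by
        ext ω
        constructor
        · rintro ⟨⟨hωM, hωB, hωH⟩, hωe⟩; exact ⟨⟨hωM, (hB1' ω hωe).1 hωB, hωH⟩, hωe⟩
        · rintro ⟨⟨hωM, hωB', hωH⟩, hωe⟩; exact ⟨⟨hωM, (hB1' ω hωe).2 hωB', hωH⟩, hωe⟩)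
    have hBH1 : prob p₁ (B ∩ H) = prob p₁ (B' ∩ H) :=
      prob_update_one_congr p (by
        ext ω
        constructor
        · rintro ⟨⟨hωB, hωH⟩, hωe⟩; exact ⟨⟨(hB1' ω hωe).1 hωB, hωH⟩, hωe⟩
        · rintro ⟨⟨hωB', hωH⟩, hωe⟩; exact ⟨⟨(hB1' ω hωe).2 hωB', hωH⟩, hωe⟩)
    have hGB'M : ∀ ω, ω ∈ G → ω ∈ B' → ω ∈ M := fun ω hωG hωB' =>
      hGBM ω hωG (fun hall => hωB' fun i hi => (mem_allOpen.1 hall) i (Finset.mem_insert_of_mem hi))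
    have hIH : prob p₁ (M ∩ (B' ∩ H)) - prob p₁ M * prob p₁ (B' ∩ H)
        ≤ prob p₁ (G ∩ H) - prob p₁ G * prob p₁ H := ih hG hH hM hMG hGB'M hp1'
    -- (ii) under `p₀`: the whole space lies in `B`, so `M = G` and `B ∩ H = H` a.s.
    have hcl : closedEdge e ⊆ B := closedEdge_subset_compl_allOpen heZ
    have hMG0 : prob p₀ M = prob p₀ G :=
      prob_update_zero_congr p (by
        ext ω
        constructor
        · rintro ⟨hωM, hωe⟩; exact ⟨hMG hωM, hωe⟩
        · rintro ⟨hωG, hωe⟩; exact ⟨hGBM ω hωG (hcl hωe), hωe⟩)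
    have hMBH0 : prob p₀ (M ∩ (B ∩ H)) = prob p₀ (G ∩ H) :=
      prob_update_zero_congr p (by
        ext ω
        constructor
        · rintro ⟨⟨hωM, _, hωH⟩, hωe⟩; exact ⟨⟨hMG hωM, hωH⟩, hωe⟩
        · rintro ⟨⟨hωG, hωH⟩, hωe⟩; exact ⟨⟨hGBM ω hωG (hcl hωe), hcl hωe, hωH⟩, hωe⟩)
    have hBH0 : prob p₀ (B ∩ H) = prob p₀ H :=
      prob_update_zero_congr p (by
        ext ω
        constructor
        · rintro ⟨⟨_, hωH⟩, hωe⟩; exact ⟨hωH, hωe⟩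
        · rintro ⟨hωH, hωe⟩; exact ⟨⟨hcl hωe, hωH⟩, hωe⟩)
    -- (iii) the cross term: `0 ≤ ΔM ≤ ΔG` and `Δ(B ∩ H) ≤ ΔH`, `0 ≤ ΔH`
    have hdM0 : 0 ≤ prob p₁ M - prob p₀ M :=
      sub_nonneg.2 (prob_update_zero_le_prob_update_one_cu hp hM e)
    have hdH0 : 0 ≤ prob p₁ H - prob p₀ H :=
      sub_nonneg.2 (prob_update_zero_le_prob_update_one_cu hp hH e)
    have hMG1 : prob p₁ M ≤ prob p₁ G := prob_mono hp1' hMG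
    have hB'H1 : prob p₁ (B' ∩ H) ≤ prob p₁ H := prob_mono hp1' Set.inter_subset_right
    have hdM0' : 0 ≤ prob p₁ M - prob p₀ G := by rw [← hMG0]; exact hdM0
    have hcross : (prob p₁ M - prob p₀ G) * (prob p₁ (B' ∩ H) - prob p₀ H)
        ≤ (prob p₁ G - prob p₀ G) * (prob p₁ H - prob p₀ H) :=
      calc (prob p₁ M - prob p₀ G) * (prob p₁ (B' ∩ H) - prob p₀ H)
          ≤ (prob p₁ M - prob p₀ G) * (prob p₁ H - prob p₀ H) :=
            mul_le_mul_of_nonneg_left (by linarith) hdM0'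
        _ ≤ (prob p₁ G - prob p₀ G) * (prob p₁ H - prob p₀ H) :=
            mul_le_mul_of_nonneg_right (by linarith) hdH0
    -- assemble
    rw [cov_eq_pin_cu p M (B ∩ H) e, cov_eq_pin_cu p G H e]
    rw [hMBH1, hBH1, hMBH0, hBH0, hMG0]
    have h1 := mul_le_mul_of_nonneg_left hIH ha0
    have h2 := mul_le_mul_of_nonneg_left hcross (mul_nonneg ha0 ha1)
    linarith

/-- Theorem B for the smallest admissible `M = ↑(G ∩ (allOpen Z)ᶜ)`, stated with the up-closure
written out: `M = {ω ∣ ∃ z ∈ G, z ∈ (allOpen Z)ᶜ ∧ z ≤ ω}`. -/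
theorem cov_inter_closedUnion_le_cov' (Z : Finset E) {G H : Set (Config E)} (hG : IsUpperSet G)
    (hH : IsUpperSet H) {p : E → R} (hp : IsProbVec p) :
    prob p ({ω | ∃ z ∈ G, z ∈ (allOpen Z)ᶜ ∧ z ≤ ω} ∩ ((allOpen Z)ᶜ ∩ H))
        - prob p {ω | ∃ z ∈ G, z ∈ (allOpen Z)ᶜ ∧ z ≤ ω} * prob p ((allOpen Z)ᶜ ∩ H)
      ≤ prob p (G ∩ H) - prob p G * prob p H := by
  refine cov_inter_closedUnion_le_cov Z hG hH ?_ ?_ ?_ hp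
  · rintro ω ω' hle ⟨z, hzG, hzB, hzω⟩
    exact ⟨z, hzG, hzB, hzω.trans hle⟩
  · rintro ω ⟨z, hzG, _, hzω⟩
    exact hG hzω hzG
  · intro ω hωG hωB
    exact ⟨ω, hωG, hωB, le_rfl⟩

end Main

end ThreeEvent

end Summit.Ventures.PercRepro2
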